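import Summits.MatrixMultiplication.MatrixMultiplication.Theorems.EdgePencilExponentConstancy
import HarnessLib

/-!
# THE BIMAXIMAL SPLIT of the leaf: `TetraExcessZero ⟺ DMaxBlind ∧ MidTight`, with
# `MidTight ⟺ ∃ a bimaximal spectral point ⟺ R̃([D_n]·[T(K₄)_n]) = R̃[D_n]·R̃[T(K₄)_n]`

Support kernel for `stmt-MatrixMultiplication-26697` (`TetraExcessZero : ω(K₄) ≤ ω(2,1,2) =: ψ`, route
`TetrahedronCarving`; cut of record `closes (TetraExcessZero) (TetraPlusTwo) : ω = 2`, UNCHANGED; lineage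
`decomp-mm-lens-6`, generation 45; sequel of `EdgePencilExponentConstancy`). No item is added or changed; no
definition is introduced. Notation as there: `X₄(F) = DTensorClass.asymptoticSpectrumDTensors F 2`,
`[t] = DTensorClass.mk t`, `W_n^{(e)} = sixTetra F n e`, `D_n = W_n^{(1)}`, `T(K₄)_n = tetra F n`,
`P_e = (i ↦ [i 0 = i 1])` on `Fin 4 → Fin e`, `R̃ = asympRankOf (· ≤ ·)`, `χ(δ) = omegaSix F δ`, `ψ = ω(2,1,2)`,
`T = ω(K₄) = omegaTetra F`; the E-coordinates of `φ ∈ X₄(F)` are `p_φ = log₂ φ[P_2] ∈ [0,1]` (sight of the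
missing edge) and `d_φ = log₂ φ[D_2] ∈ [0, ψ]` (diamond rate), spelled out in every statement. Two statements
about `X₄(F)`, both inline (no `def`):

* `DMaxBlind : ∀ φ ∈ X₄, d_φ = ψ → p_φ = 0` — every DIAMOND-MAXIMAL spectral point is BLIND to the missing edge;
* `MidTight : ψ + T ≤ 2χ(1/2)` — the statement of the registered `stub_midTight` of the line `rung_and_chord`.

§33 SIGHT IS BOUNDED BY EXCESS AND KILLED BY ANY RUNG (`coord_pair_le_excess_of_diamond_max`,
`coord_pair_eq_zero_of_sixRung`, `dMaxBlind_of_sixRungPos`, `dMaxBlind_of_trop`): a diamond-maximal point has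
`p_φ ≤ T − ψ`; `χ(log_n e) ≤ ψ` with `e ≥ 2` gives `ψ + (log_n e)·p_φ ≤ ψ`, so `p_φ = 0`. Hence
`SixRungPos ⟹ DMaxBlind` and `TROP(n,e) ⟹ DMaxBlind` (`sixRung_of_trop`; no star-convexity hypothesis).

§34 `MidTight ⟺ BIMAXIMALITY ⟺ KRONECKER TIGHTNESS` (`midTight_iff_exists_bimaximal`,
`midTight_iff_exists_bimaximal_asympRank`, `midTight_iff_asympRank_mul`, `midTight_iff_asympRank_mul_eq`):
`ψ + T ≤ 2χ(1/2)` iff some `φ ∈ X₄(F)` is maximal on the diamond AND on the tetrahedron (`d_φ = ψ ∧ p_φ + d_φ = T`;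
at base `n`: `φ[D_n] = R̃[D_n] ∧ φ[T(K₄)_n] = R̃[T(K₄)_n]`) iff asymptotic rank is MULTIPLICATIVE on the one
Kronecker product `[D_n]·[T(K₄)_n] = [W_{n·n}^{(n)}]` (`mk_diamond_mul_tetra`): `R̃([D_n]·[T(K₄)_n]) =
R̃[D_n]·R̃[T(K₄)_n]` (`≤` always, `asympRank_diamond_mul_tetra_le`; `=` iff a common maximiser exists). The first
equivalence is the support-function identity `χ(1/2) = max_φ (d_φ + p_φ/2)` (base `4`, thickness `2`,
`log₄ 2 = 1/2`) against `d ≤ ψ`, `p + d ≤ T`.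

§35 THE SPLIT (`excessZero_iff_dMaxBlind_and_midTight`; over `ℂ` by name
`tetraExcessZero_iff_dMaxBlind_and_midTight`, `matrixMultiplication_iff_dMaxBlind_midTight_plusTwo`):

  `TetraExcessZero ⟺ DMaxBlind ∧ MidTight`,   `ω = 2 ⟺ (DMaxBlind ∧ MidTight) ∧ TetraPlusTwo`,

both pieces NEC (`dMaxBlind_of_matrixMultiplication`, `sixRungPos_and_midTight_of_matrixMultiplication`). With
`s* = max {p_φ : φ diamond-maximal} ∈ [0, T − ψ]`: `DMaxBlind ⟺ s* = 0`, `MidTight ⟺ s* = T − ψ`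
(`midTight_iff_exists_dMax_sight_eq_excess`), the leaf `⟺ T = ψ`. `DMaxBlind` is weaker than the registered
`stub_sixRungPos` (`SixRungPos ⟹ DMaxBlind`), is `ω`-free, and replaces it without loss:
`DMaxBlind → MidTight → TetraExcessZero` (`tetraExcessZero_of_dMaxBlind_of_midTight`).

References: Strassen 1988, Thm. 3.8 [Strassen1988]; Zuiddam 2018, Thm. 2.12, Cor. 2.13 [Zuiddam2018];
Christandl–Vrana–Zuiddam 2023, Thm. 1.1, Prop. 1.6 [ChristandlVranaZuiddam2023]; Christandl–Vrana–Zuiddam,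
arXiv:1609.07476, §1.1 [ChristandlVranaZuiddam2016]; Lotti–Romani 1983, §2 [LottiRomani1983]. No `sorry`, no new
axiom, no instance, no notation, no definition.
-/

noncomputable section

set_option linter.dupNamespace false

open Filter Finset Literature.Computability.AlgebraicComplexity
open Summit.MatrixMultiplication.MatrixMultiplication.Theorems.TetrahedronTensor
open Summit.MatrixMultiplication.MatrixMultiplication.Theorems.TetraDiagonal
open Summit.MatrixMultiplication.MatrixMultiplication.Theses.TetrahedronCarving

namespace Summit.MatrixMultiplication.MatrixMultiplication.Theorems.EdgePencil

/-! ## §33 Arithmetic of log-rational slopes; sight is bounded by excess; rungs kill sight -/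

section Slopes

/-- `log_{2^k} 2^j = j/k`. [folklore] -/
theorem logb_two_pow_two_pow (j k : ℕ) : Real.logb ((2 : ℝ) ^ k) ((2 : ℝ) ^ j) = (j : ℝ) / k := by
  have h2 : Real.log 2 ≠ 0 := (Real.log_pos one_lt_two).ne'
  rw [← Real.log_div_log, Real.log_pow, Real.log_pow, mul_div_mul_right _ _ h2]

/-- `b^x = b^y ⟺ x = y` for `1 < b`. [folklore] -/
theorem rpow_eq_rpow_iff_of_one_lt {b x y : ℝ} (hb : 1 < b) : b ^ x = b ^ y ↔ x = y :=
  ⟨fun h => le_antisymm ((Real.rpow_le_rpow_left_iff hb).1 h.le) ((Real.rpow_le_rpow_left_iff hb).1 h.ge),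
    fun h => by rw [h]⟩

variable (F : Type) [Field F]

/-- **SIGHT ≤ EXCESS**: a diamond-maximal point (`d_φ = ψ`) sees the missing edge at rate `p_φ ≤ T − ψ`.
[cite: Strassen1988, Thm. 3.8] -/
theorem coord_pair_le_excess_of_diamond_max {φ : DTensorClass F 4 → ℝ}
    (hφ : φ ∈ DTensorClass.asymptoticSpectrumDTensors F 2)
    (hd : Real.logb 2 (φ (DTensorClass.mk (sixTetra F 2 1))) = omegaRect F 2 1 2) :
    Real.logb 2 (φ (DTensorClass.mk (fun i : Fin 4 → Fin 2 => (ind (i 0 = i 1) : F)))) ≤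
      omegaTetra F - omegaRect F 2 1 2 := by
  have h := coord_sum_le_omegaTetra F hφ
  linarith

/-- **A RUNG OF POSITIVE SLOPE KILLS SIGHT**: `χ(log_n e) ≤ ψ` with `2 ≤ e ≤ n` forces `p_φ = 0` for every
diamond-maximal `φ` (`ψ + (log_n e) p_φ ≤ χ(log_n e) ≤ ψ`). [cite: Strassen1988, Thm. 3.8] -/
theorem coord_pair_eq_zero_of_sixRung {n e : ℕ} (hn : 2 ≤ n) (he2 : 2 ≤ e) (he : e ≤ n)
    (hr : omegaSix F (Real.logb n e) ≤ omegaRect F 2 1 2)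
    {φ : DTensorClass F 4 → ℝ} (hφ : φ ∈ DTensorClass.asymptoticSpectrumDTensors F 2)
    (hd : Real.logb 2 (φ (DTensorClass.mk (sixTetra F 2 1))) = omegaRect F 2 1 2) :
    Real.logb 2 (φ (DTensorClass.mk (fun i : Fin 4 → Fin 2 => (ind (i 0 = i 1) : F)))) = 0 := by
  have hn1' : (1 : ℝ) < n := by exact_mod_cast (show 1 < n by omega)
  have he1' : (1 : ℝ) < e := by exact_mod_cast (show 1 < e by omega)
  have hδ : 0 < Real.logb n e := Real.logb_pos hn1' he1'
  have hc := coord_le_omegaSix F hn (by omega) he hφ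
  rw [hd] at hc
  obtain ⟨hp0, -⟩ := coord_pair_mem hφ
  have hmul : Real.logb n e * Real.logb 2 (φ (DTensorClass.mk (fun i : Fin 4 → Fin 2 => (ind (i 0 = i 1) : F))))
      ≤ Real.logb n e * 0 := by linarith
  exact le_antisymm (le_of_mul_le_mul_left hmul hδ) hp0

/-- **`SixRungPos ⟹ DMaxBlind`**: `∃ δ > 0, χ(δ) ≤ ψ` forces every diamond-maximal point of `X₄(F)` to be
blind (`d_φ = ψ → p_φ = 0`; rung scale `δ ≥ 1/k = log_{2^k} 2`). [cite: Strassen1988, Thm. 3.8] -/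
theorem dMaxBlind_of_sixRungPos (hr : ∃ δ : ℝ, 0 < δ ∧ omegaSix F δ ≤ omegaRect F 2 1 2) :
    ∀ φ ∈ DTensorClass.asymptoticSpectrumDTensors F 2,
      Real.logb 2 (φ (DTensorClass.mk (sixTetra F 2 1))) = omegaRect F 2 1 2 →
        Real.logb 2 (φ (DTensorClass.mk (fun i : Fin 4 → Fin 2 => (ind (i 0 = i 1) : F)))) = 0 := by
  intro φ hφ hd
  obtain ⟨δ, hδ, hr⟩ := hr
  obtain ⟨k, hk⟩ := exists_nat_ge (1 / δ)
  have hk0 : (0 : ℝ) < k := lt_of_lt_of_le (by positivity) hk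
  have hkpos : 0 < k := by exact_mod_cast hk0
  have hn2 : 2 ≤ 2 ^ k := Nat.one_lt_two_pow_iff.2 (by omega)
  have hlog : Real.logb ((2 ^ k : ℕ) : ℝ) ((2 : ℕ) : ℝ) = 1 / k := by
    have h := logb_two_pow_two_pow 1 k
    rw [pow_one, Nat.cast_one] at h
    push_cast
    exact h
  have hle : 1 / (k : ℝ) ≤ δ := (one_div_le hk0 hδ).2 hk
  refine coord_pair_eq_zero_of_sixRung F hn2 le_rfl hn2 ?_ hφ hd
  rw [hlog]
  exact (omegaSix_mono F hle).trans hr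

/-- **`TROP(n,e) ⟹ DMaxBlind`** (`2 ≤ e ≤ n`; NO star-convexity hypothesis): one base of tropical domination
is a rung at slope `log_n e > 0` (`sixRung_of_trop`). [cite: ChristandlVranaZuiddam2016, §1.1] -/
theorem dMaxBlind_of_trop {n e : ℕ} (hn : 2 ≤ n) (he2 : 2 ≤ e) (he : e ≤ n)
    (hT : ∀ φ ∈ DTensorClass.asymptoticSpectrumDTensors F 2,
      φ (DTensorClass.mk (sixTetra F n e)) ≤ max (φ (DTensorClass.mk (sixTetra F n 1))) ((n : ℝ) ^ 4)) :
    ∀ φ ∈ DTensorClass.asymptoticSpectrumDTensors F 2,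
      Real.logb 2 (φ (DTensorClass.mk (sixTetra F 2 1))) = omegaRect F 2 1 2 →
        Real.logb 2 (φ (DTensorClass.mk (fun i : Fin 4 → Fin 2 => (ind (i 0 = i 1) : F)))) = 0 :=
  fun _ hφ hd => coord_pair_eq_zero_of_sixRung F hn he2 he (sixRung_of_trop F hn (by omega) he hT) hφ hd

end Slopes

/-! ## §34 `MidTight ⟺` a bimaximal point exists `⟺` Kronecker tightness `R̃(D ⊠ T) = R̃(D)·R̃(T)` -/

section Bimaximal

variable (F : Type) [Field F]

/-- **`MidTight ⟺ ∃ BIMAXIMAL POINT`**: `ψ + T ≤ 2χ(1/2)` iff some `φ ∈ X₄(F)` has `d_φ = ψ` and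
`p_φ + d_φ = T` (support function at slope `1/2 = log₄ 2`: `χ(1/2) = max (d + p/2) ≤ (ψ + T)/2`, with equality
iff both constraints are tight at the maximiser). [cite: Zuiddam2018, Cor. 2.13] -/
theorem midTight_iff_exists_bimaximal :
    omegaRect F 2 1 2 + omegaTetra F ≤ 2 * omegaSix F (1 / 2) ↔
      ∃ φ ∈ DTensorClass.asymptoticSpectrumDTensors F 2,
        Real.logb 2 (φ (DTensorClass.mk (sixTetra F 2 1))) = omegaRect F 2 1 2 ∧
          Real.logb 2 (φ (DTensorClass.mk (fun i : Fin 4 → Fin 2 => (ind (i 0 = i 1) : F)))) +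
            Real.logb 2 (φ (DTensorClass.mk (sixTetra F 2 1))) = omegaTetra F := by
  have hlog : Real.logb ((4 : ℕ) : ℝ) ((2 : ℕ) : ℝ) = 1 / 2 := by
    have h := logb_two_pow_two_pow 1 2
    norm_num at h
    push_cast
    rw [h]
  constructor
  · intro hmid
    obtain ⟨φ, hφ, hφeq⟩ := exists_coord_eq_omegaSix F (n := 4) (e := 2) (by norm_num) (by norm_num) (by norm_num)
    rw [hlog] at hφeq
    refine ⟨φ, hφ, ?_, ?_⟩
    · linarith [(coord_diamond_mem F hφ).2, coord_sum_le_omegaTetra F hφ]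
    · linarith [(coord_diamond_mem F hφ).2, coord_sum_le_omegaTetra F hφ]
  · rintro ⟨φ, hφ, hd, hsum⟩
    have hc := coord_le_omegaSix F (n := 4) (e := 2) (by norm_num) (by norm_num) (by norm_num) hφ
    rw [hlog] at hc
    linarith

/-- **`MidTight ⟺` some diamond-maximal point has SIGHT = EXCESS** (`d_φ = ψ ∧ p_φ = T − ψ`).
[cite: Zuiddam2018, Cor. 2.13] -/
theorem midTight_iff_exists_dMax_sight_eq_excess :
    omegaRect F 2 1 2 + omegaTetra F ≤ 2 * omegaSix F (1 / 2) ↔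
      ∃ φ ∈ DTensorClass.asymptoticSpectrumDTensors F 2,
        Real.logb 2 (φ (DTensorClass.mk (sixTetra F 2 1))) = omegaRect F 2 1 2 ∧
          Real.logb 2 (φ (DTensorClass.mk (fun i : Fin 4 → Fin 2 => (ind (i 0 = i 1) : F)))) =
            omegaTetra F - omegaRect F 2 1 2 := by
  rw [midTight_iff_exists_bimaximal F]
  refine exists_congr fun φ => and_congr_right fun _ => ?_
  constructor
  · rintro ⟨hd, h⟩
    exact ⟨hd, by linarith⟩
  · rintro ⟨hd, h⟩
    exact ⟨hd, by linarith⟩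

/-- **`MidTight ⟺ ∃ φ ∈ X₄(F), φ[D_n] = R̃[D_n] ∧ φ[T(K₄)_n] = R̃[T(K₄)_n]`** at any single base `n ≥ 2`.
[cite: Zuiddam2018, Cor. 2.13] -/
theorem midTight_iff_exists_bimaximal_asympRank {n : ℕ} (hn : 2 ≤ n) :
    omegaRect F 2 1 2 + omegaTetra F ≤ 2 * omegaSix F (1 / 2) ↔
      ∃ φ ∈ DTensorClass.asymptoticSpectrumDTensors F 2,
        φ (DTensorClass.mk (sixTetra F n 1)) =
            asympRankOf (fun x y : DTensorClass F 4 => x ≤ y) (DTensorClass.mk (sixTetra F n 1)) ∧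
          φ (DTensorClass.mk (tetra F n)) =
            asympRankOf (fun x y : DTensorClass F 4 => x ≤ y) (DTensorClass.mk (tetra F n)) := by
  rw [midTight_iff_exists_bimaximal F]
  have hn1' : (1 : ℝ) < n := by exact_mod_cast (show 1 < n by omega)
  refine exists_congr fun φ => and_congr_right fun hφ => ?_
  rw [spectrum_diamond_eq_rpow hφ (by omega : 1 ≤ n), ← rpow_omegaRect_eq_asympRank_diamond F hn,
    spectrum_tetra_eq_rpow hφ (by omega : 1 ≤ n), logb_spectrum_tetra_two hφ,
    ← rpow_omegaTetra_eq_asympRank F hn, rpow_eq_rpow_iff_of_one_lt hn1', rpow_eq_rpow_iff_of_one_lt hn1']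

/-- **The Kronecker product of the diamond and the tetrahedron is a pencil member**:
`[D_n]·[T(K₄)_n] = [W_{n·n}^{(n)}]`. [cite: ChristandlVranaZuiddam2016, §1.1] -/
theorem mk_diamond_mul_tetra {n : ℕ} (hn : 1 ≤ n) :
    DTensorClass.mk (sixTetra F n 1) * DTensorClass.mk (tetra F n) = DTensorClass.mk (sixTetra F (n * n) n) := by
  rw [← sixTetra_of_le (le_refl n), mk_sixTetra_mul hn le_rfl, one_mul]

/-- `φ([D_n]·[T(K₄)_n]) = φ[D_n]·φ[T(K₄)_n]`. [cite: Zuiddam2018, Def. 2.8] -/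
theorem spectrum_diamond_mul_tetra (n : ℕ) {φ : DTensorClass F 4 → ℝ}
    (hφ : φ ∈ DTensorClass.asymptoticSpectrumDTensors F 2) :
    φ (DTensorClass.mk (sixTetra F n 1) * DTensorClass.mk (tetra F n)) =
      φ (DTensorClass.mk (sixTetra F n 1)) * φ (DTensorClass.mk (tetra F n)) :=
  (DTensorClass.mem_asymptoticSpectrumDTensors_iff.1 hφ).map_mul _ _

/-- `1 ≤ φ[T(K₄)_n]` (`n ≥ 1`). [cite: Zuiddam2018, Def. 2.8] -/
theorem one_le_spectrum_tetra {n : ℕ} (hn : 1 ≤ n) {φ : DTensorClass F 4 → ℝ}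
    (hφ : φ ∈ DTensorClass.asymptoticSpectrumDTensors F 2) :
    1 ≤ φ (DTensorClass.mk (tetra F n)) := by
  rw [← sixTetra_of_le (le_refl n)]
  exact one_le_spectrum_sixTetra hn hn hφ

/-- **Sub-multiplicativity on the pair**: `R̃([D_n]·[T(K₄)_n]) ≤ R̃[D_n]·R̃[T(K₄)_n]` (`n ≥ 1`).
[cite: ChristandlVranaZuiddam2023, Prop. 1.6] -/
theorem asympRank_diamond_mul_tetra_le {n : ℕ} (hn : 1 ≤ n) :
    asympRankOf (fun x y : DTensorClass F 4 => x ≤ y)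
        (DTensorClass.mk (sixTetra F n 1) * DTensorClass.mk (tetra F n)) ≤
      asympRankOf (fun x y : DTensorClass F 4 => x ≤ y) (DTensorClass.mk (sixTetra F n 1)) *
        asympRankOf (fun x y : DTensorClass F 4 => x ≤ y) (DTensorClass.mk (tetra F n)) := by
  obtain ⟨φ, hφ, hφeq⟩ := DTensorClass.exists_mem_spectrum_apply_eq_asympRankOf
    (DTensorClass.mk (sixTetra F n 1) * DTensorClass.mk (tetra F n))
  rw [← hφeq, spectrum_diamond_mul_tetra F n hφ]
  have hD1 : 1 ≤ φ (DTensorClass.mk (sixTetra F n 1)) := one_le_spectrum_sixTetra hn le_rfl hφ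
  have hT1 := one_le_spectrum_tetra F hn hφ
  exact mul_le_mul (DTensorClass.le_asympRankOf hφ _) (DTensorClass.le_asympRankOf hφ _) (by linarith)
    (by linarith [DTensorClass.le_asympRankOf hφ (DTensorClass.mk (sixTetra F n 1))])

/-- **`MidTight ⟺ KRONECKER TIGHTNESS`**: `ψ + T ≤ 2χ(1/2)` iff asymptotic rank is multiplicative on the one
product `[D_n]·[T(K₄)_n]`, i.e. `R̃[D_n]·R̃[T(K₄)_n] ≤ R̃([D_n]·[T(K₄)_n])` (`n ≥ 2`; a common maximiser).
[cite: ChristandlVranaZuiddam2023, Prop. 1.6] -/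
theorem midTight_iff_asympRank_mul {n : ℕ} (hn : 2 ≤ n) :
    omegaRect F 2 1 2 + omegaTetra F ≤ 2 * omegaSix F (1 / 2) ↔
      asympRankOf (fun x y : DTensorClass F 4 => x ≤ y) (DTensorClass.mk (sixTetra F n 1)) *
          asympRankOf (fun x y : DTensorClass F 4 => x ≤ y) (DTensorClass.mk (tetra F n)) ≤
        asympRankOf (fun x y : DTensorClass F 4 => x ≤ y)
          (DTensorClass.mk (sixTetra F n 1) * DTensorClass.mk (tetra F n)) := by
  rw [midTight_iff_exists_bimaximal_asympRank F hn]
  constructor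
  · rintro ⟨φ, hφ, hD, hT⟩
    rw [← hD, ← hT, ← spectrum_diamond_mul_tetra F n hφ]
    exact DTensorClass.le_asympRankOf hφ _
  · intro h
    obtain ⟨φ, hφ, hφeq⟩ := DTensorClass.exists_mem_spectrum_apply_eq_asympRankOf
      (DTensorClass.mk (sixTetra F n 1) * DTensorClass.mk (tetra F n))
    rw [← hφeq, spectrum_diamond_mul_tetra F n hφ] at h
    have hDle := DTensorClass.le_asympRankOf hφ (DTensorClass.mk (sixTetra F n 1))
    have hTle := DTensorClass.le_asympRankOf hφ (DTensorClass.mk (tetra F n))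
    have hD1 : 1 ≤ φ (DTensorClass.mk (sixTetra F n 1)) := one_le_spectrum_sixTetra (by omega) le_rfl hφ
    have hT1 := one_le_spectrum_tetra F (by omega : 1 ≤ n) hφ
    refine ⟨φ, hφ, ?_, ?_⟩
    · by_contra hne
      have hlt := lt_of_le_of_ne hDle hne
      have : φ (DTensorClass.mk (sixTetra F n 1)) * φ (DTensorClass.mk (tetra F n)) <
          asympRankOf (fun x y : DTensorClass F 4 => x ≤ y) (DTensorClass.mk (sixTetra F n 1)) *
            asympRankOf (fun x y : DTensorClass F 4 => x ≤ y) (DTensorClass.mk (tetra F n)) :=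
        calc _ < asympRankOf (fun x y : DTensorClass F 4 => x ≤ y) (DTensorClass.mk (sixTetra F n 1)) *
              φ (DTensorClass.mk (tetra F n)) := mul_lt_mul_of_pos_right hlt (by linarith)
          _ ≤ _ := mul_le_mul_of_nonneg_left hTle (by linarith)
      linarith
    · by_contra hne
      have hlt := lt_of_le_of_ne hTle hne
      have : φ (DTensorClass.mk (sixTetra F n 1)) * φ (DTensorClass.mk (tetra F n)) <
          asympRankOf (fun x y : DTensorClass F 4 => x ≤ y) (DTensorClass.mk (sixTetra F n 1)) *
            asympRankOf (fun x y : DTensorClass F 4 => x ≤ y) (DTensorClass.mk (tetra F n)) :=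
        calc _ < φ (DTensorClass.mk (sixTetra F n 1)) *
              asympRankOf (fun x y : DTensorClass F 4 => x ≤ y) (DTensorClass.mk (tetra F n)) :=
              mul_lt_mul_of_pos_left hlt (by linarith)
          _ ≤ _ := mul_le_mul_of_nonneg_right hDle (by linarith [hTle])
      linarith

/-- **`MidTight ⟺ R̃([D_n]·[T(K₄)_n]) = R̃[D_n]·R̃[T(K₄)_n]`** (`n ≥ 2`): the diamond and the tetrahedron do not
amortise against each other. [cite: ChristandlVranaZuiddam2023, Prop. 1.6] -/
theorem midTight_iff_asympRank_mul_eq {n : ℕ} (hn : 2 ≤ n) :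
    omegaRect F 2 1 2 + omegaTetra F ≤ 2 * omegaSix F (1 / 2) ↔
      asympRankOf (fun x y : DTensorClass F 4 => x ≤ y)
          (DTensorClass.mk (sixTetra F n 1) * DTensorClass.mk (tetra F n)) =
        asympRankOf (fun x y : DTensorClass F 4 => x ≤ y) (DTensorClass.mk (sixTetra F n 1)) *
          asympRankOf (fun x y : DTensorClass F 4 => x ≤ y) (DTensorClass.mk (tetra F n)) := by
  rw [midTight_iff_asympRank_mul F hn]
  exact ⟨fun h => le_antisymm (asympRank_diamond_mul_tetra_le F (by omega)) h, fun h => h.ge⟩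

end Bimaximal

/-! ## §35 The split `TetraExcessZero ⟺ DMaxBlind ∧ MidTight`, by name over `ℂ`; NEC -/

section Split

variable (F : Type) [Field F]

/-- **THE BIMAXIMAL SPLIT** (any field): `T ≤ ψ ⟺ DMaxBlind ∧ MidTight` — (⟹) the leaf gives `SixRungPos`
(`excessZero_iff_sixRungPos_and_midTight`) hence `DMaxBlind`; (⟸) the bimaximal point of `MidTight` is
diamond-maximal, hence blind, so `T = p + d = d = ψ`. [cite: LottiRomani1983, §2 (p. 174)] -/
theorem excessZero_iff_dMaxBlind_and_midTight :
    omegaTetra F ≤ omegaRect F 2 1 2 ↔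
      (∀ φ ∈ DTensorClass.asymptoticSpectrumDTensors F 2,
        Real.logb 2 (φ (DTensorClass.mk (sixTetra F 2 1))) = omegaRect F 2 1 2 →
          Real.logb 2 (φ (DTensorClass.mk (fun i : Fin 4 → Fin 2 => (ind (i 0 = i 1) : F)))) = 0) ∧
        omegaRect F 2 1 2 + omegaTetra F ≤ 2 * omegaSix F (1 / 2) := by
  constructor
  · intro hA
    obtain ⟨hr, hmid⟩ := (excessZero_iff_sixRungPos_and_midTight F).1 hA
    exact ⟨dMaxBlind_of_sixRungPos F hr, hmid⟩
  · rintro ⟨hB, hmid⟩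
    obtain ⟨φ, hφ, hd, hsum⟩ := (midTight_iff_exists_bimaximal F).1 hmid
    have hp := hB φ hφ hd
    linarith

/-- Under `DMaxBlind`, `MidTight ⟺` the leaf. [cite: LottiRomani1983, §2 (p. 174)] -/
theorem midTight_iff_excessZero_of_dMaxBlind
    (hB : ∀ φ ∈ DTensorClass.asymptoticSpectrumDTensors F 2,
      Real.logb 2 (φ (DTensorClass.mk (sixTetra F 2 1))) = omegaRect F 2 1 2 →
        Real.logb 2 (φ (DTensorClass.mk (fun i : Fin 4 → Fin 2 => (ind (i 0 = i 1) : F)))) = 0) :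
    omegaRect F 2 1 2 + omegaTetra F ≤ 2 * omegaSix F (1 / 2) ↔ omegaTetra F ≤ omegaRect F 2 1 2 := by
  rw [excessZero_iff_dMaxBlind_and_midTight F]
  exact ⟨fun h => ⟨hB, h⟩, fun h => h.2⟩

/-- **BY NAME over `ℂ`**: `TetraExcessZero ⟺ DMaxBlind ∧ MidTight`. [cite: LottiRomani1983, §2 (p. 174)] -/
theorem tetraExcessZero_iff_dMaxBlind_and_midTight :
    TetraExcessZero ↔
      (∀ φ ∈ DTensorClass.asymptoticSpectrumDTensors ℂ 2,
        Real.logb 2 (φ (DTensorClass.mk (sixTetra ℂ 2 1))) = omegaRect ℂ 2 1 2 →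
          Real.logb 2 (φ (DTensorClass.mk (fun i : Fin 4 → Fin 2 => (ind (i 0 = i 1) : ℂ)))) = 0) ∧
        omegaRect ℂ 2 1 2 + omegaTetra ℂ ≤ 2 * omegaSix ℂ (1 / 2) :=
  excessZero_iff_dMaxBlind_and_midTight ℂ

/-- **The line with its first stub weakened decides the crux**: `DMaxBlind → MidTight → TetraExcessZero`.
[cite: LottiRomani1983, §2 (p. 174)] -/
theorem tetraExcessZero_of_dMaxBlind_of_midTight
    (hB : ∀ φ ∈ DTensorClass.asymptoticSpectrumDTensors ℂ 2,
      Real.logb 2 (φ (DTensorClass.mk (sixTetra ℂ 2 1))) = omegaRect ℂ 2 1 2 →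
        Real.logb 2 (φ (DTensorClass.mk (fun i : Fin 4 → Fin 2 => (ind (i 0 = i 1) : ℂ)))) = 0)
    (hmid : omegaRect ℂ 2 1 2 + omegaTetra ℂ ≤ 2 * omegaSix ℂ (1 / 2)) : TetraExcessZero :=
  (excessZero_iff_dMaxBlind_and_midTight ℂ).2 ⟨hB, hmid⟩

/-- `TetraExcessZero ⟹ DMaxBlind`. [cite: Strassen1988, Thm. 3.8] -/
theorem dMaxBlind_of_tetraExcessZero (hE : TetraExcessZero) :
    ∀ φ ∈ DTensorClass.asymptoticSpectrumDTensors ℂ 2,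
      Real.logb 2 (φ (DTensorClass.mk (sixTetra ℂ 2 1))) = omegaRect ℂ 2 1 2 →
        Real.logb 2 (φ (DTensorClass.mk (fun i : Fin 4 → Fin 2 => (ind (i 0 = i 1) : ℂ)))) = 0 :=
  ((excessZero_iff_dMaxBlind_and_midTight ℂ).1 hE).1

/-- **NEC**: `ω = 2 ⟹ DMaxBlind`. [cite: Strassen1988, Thm. 3.8] -/
theorem dMaxBlind_of_matrixMultiplication (hS : _root_.MatrixMultiplication) :
    ∀ φ ∈ DTensorClass.asymptoticSpectrumDTensors ℂ 2,
      Real.logb 2 (φ (DTensorClass.mk (sixTetra ℂ 2 1))) = omegaRect ℂ 2 1 2 →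
        Real.logb 2 (φ (DTensorClass.mk (fun i : Fin 4 → Fin 2 => (ind (i 0 = i 1) : ℂ)))) = 0 :=
  dMaxBlind_of_tetraExcessZero (excessZero_of_matrixMultiplication hS)

/-- **THE SUMMIT THROUGH THE BIMAXIMAL SPLIT**: `ω = 2 ⟺ (DMaxBlind ∧ MidTight) ∧ TetraPlusTwo` (the route's cut
`closes (hA : TetraExcessZero) (hB : TetraPlusTwo)` with `hA` split at the spectral level). -/
theorem matrixMultiplication_iff_dMaxBlind_midTight_plusTwo :
    _root_.MatrixMultiplication ↔
      ((∀ φ ∈ DTensorClass.asymptoticSpectrumDTensors ℂ 2,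
        Real.logb 2 (φ (DTensorClass.mk (sixTetra ℂ 2 1))) = omegaRect ℂ 2 1 2 →
          Real.logb 2 (φ (DTensorClass.mk (fun i : Fin 4 → Fin 2 => (ind (i 0 = i 1) : ℂ)))) = 0) ∧
        omegaRect ℂ 2 1 2 + omegaTetra ℂ ≤ 2 * omegaSix ℂ (1 / 2)) ∧ TetraPlusTwo := by
  rw [matrixMultiplication_iff_sixRungPos_midTight_plusTwo, ← tetraExcessZero_iff_sixRungPos_and_midTight,
    tetraExcessZero_iff_dMaxBlind_and_midTight]

end Split

end Summit.MatrixMultiplication.MatrixMultiplication.Theorems.EdgePencil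

end
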